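import Summits.AtomisticToContinuum.Crystallization.Theorems.PricedLinkCensusLocalToGlobalThomsonInequality
import Summits.AtomisticToContinuum.Crystallization.Theorems.PricedLinkCensusLocalToGlobalThomsonEscape

/-!
# The confined Thomson inequality with free transfer (stub `stub_confinedThomson`)

Route `PricedLinkCensus`, crux `LocalToGlobal` (stmt-AtomisticToContinuum-14232), line
`flux-cell-joint-census`, registered stub `stub_confinedThomson : ConfinedThomson`
(`Theorems/PricedLinkCensusLocalToGlobalDefs`): for pairwise disjoint open cells `Ωᵢ ⊂ ℝ³` containing
the smearing balls `B(xᵢ, εᵢ)` and a square-integrable transfer field `G` which is weakly divergence-free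
on the union of the tubes,

  `Σᵢ Σ_{j ≠ i} smearedPair xᵢ xⱼ εᵢ εⱼ ≤ Σᵢ fluxCell Ωᵢ xᵢ εᵢ G`.

Contents: the charge density `ρ = Σᵢ cᵢ 𝟙_{Bᵢ}` of the smeared configuration (`chargeDensity`,
`PricedLinkCensusLocalToGlobalThomsonDefs`) is integrable, bounded, vanishes off a ball, `∫ ρ φ = Σᵢ ⨍_{Bᵢ} φ`,
and its Coulomb double integral is `Σᵢ Σⱼ smearedPair xᵢ xⱼ εᵢ εⱼ` (bilinear expansion; the mixed potentials
`x ↦ ∫_{Bⱼ} ‖x - z‖⁻⁶ dz` are strongly measurable and bounded); fields vanishing off pairwise disjoint tubes have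
`‖Σᵢ Fᵢ(z)‖² = Σᵢ ‖Fᵢ(z)‖²`; the weak divergence of the glued field; the stub.

Proof (the analytic engine of the line).  For `δ > 0` pick admissible `Fᵢ` with
`∫‖Fᵢ‖² < tubeEnergyᵢ + δ` (the admissible sets are NON-EMPTY: explicit transverse escape flux,
`PricedLinkCensusLocalToGlobalThomsonEscape`).  The glued field `F = Σᵢ Fᵢ ∈ L²(ℝ⁸; ℝ⁸)` has weak
divergence `ρ = Σᵢ (vol Bᵢ)⁻¹ 𝟙_{Bᵢ}` on all of `ℝ⁸` (disjointness of the tubes and the hypothesis on `G`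
make the wall fluxes cancel), so THOMSON'S INEQUALITY in `ℝ⁸` (`PricedLinkCensusLocalToGlobalThomsonInequality`,
the Newton kernel being `‖z‖⁻⁶/(2π⁴)`) gives `∫ρ∫ρ‖·-·‖⁻⁶ ≤ 2π⁴ ∫‖F‖²`; the left side is `Σᵢⱼ smearedPair`
(`PricedLinkCensusLocalToGlobalThomsonGlue`), the right side is `2π⁴ Σᵢ ∫‖Fᵢ‖²` (disjoint supports)
`< 2π⁴ Σᵢ (tubeEnergyᵢ + δ)`.  Let `δ → 0` and subtract the self terms.

References: W. Thomson 1848 / Dirichlet's principle; E. H. Lieb, M. Loss, *Analysis* (2001), Thm 9.8,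
§11.15; O. D. Kellogg, *Foundations of Potential Theory* (1929), Ch. XI.
-/

noncomputable section

open MeasureTheory Set Filter Metric Topology InnerProductSpace Function
open scoped RealInnerProductSpace BigOperators

namespace Summit.AtomisticToContinuum.Crystallization.Theorems.PricedLinkCensusLocalToGlobal

variable {N : ℕ}

/-! ### The charge density -/

variable (x : Fin N → E3) (ε : Fin N → ℝ)

/-- `0 ≤ cᵢ`. [folklore] -/
theorem chargeConst_nonneg (i : Fin N) : 0 ≤ chargeConst x ε i := by
  unfold chargeConst; positivity

/-- `ρ` is integrable. [folklore] -/
theorem integrable_chargeDensity : Integrable (chargeDensity x ε) := by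
  refine integrable_finsetSum _ fun i _ => Integrable.const_mul ?_ _
  exact (integrable_indicator_iff measurableSet_ball).2 (integrableOn_const measure_ball_lt_top.ne)

/-- `ρ` is measurable. [folklore] -/
theorem measurable_chargeDensity : Measurable (chargeDensity x ε) := by
  refine Finset.measurable_sum _ fun i _ => (measurable_const.indicator measurableSet_ball).const_mul _

/-- `|ρ| ≤ Σᵢ cᵢ`. [folklore] -/
theorem abs_chargeDensity_le (z : E8) : |chargeDensity x ε z| ≤ ∑ i, chargeConst x ε i := by
  refine (Finset.abs_sum_le_sum_abs _ _).trans (Finset.sum_le_sum fun i _ => ?_)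
  rw [abs_mul, abs_of_nonneg (chargeConst_nonneg x ε i)]
  refine mul_le_of_le_one_right (chargeConst_nonneg x ε i) ?_
  by_cases hz : z ∈ ball (emb (x i)) (ε i)
  · rw [indicator_of_mem hz, abs_one]
  · rw [indicator_of_notMem hz, abs_zero]; exact zero_le_one

/-- `0 ≤ R₀`. [folklore] -/
theorem chargeRadius_nonneg : 0 ≤ chargeRadius x ε := Finset.sum_nonneg fun i _ => by positivity

/-- Each ball lies within `B̄(0, R₀)`: points with `‖z‖ > R₀` are in no `Bᵢ`. [folklore] -/
theorem not_mem_ball_of_chargeRadius_lt {z : E8} (hz : chargeRadius x ε < ‖z‖) (i : Fin N) :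
    z ∉ ball (emb (x i)) (ε i) := by
  intro h
  rw [mem_ball, dist_eq_norm] at h
  have h1 : ‖emb (x i)‖ + |ε i| ≤ chargeRadius x ε :=
    Finset.single_le_sum (f := fun i => ‖emb (x i)‖ + |ε i|) (fun i _ => by positivity) (Finset.mem_univ i)
  have h2 : ‖z‖ ≤ ‖z - emb (x i)‖ + ‖emb (x i)‖ := norm_le_norm_sub_add z (emb (x i))
  linarith [le_abs_self (ε i)]

/-- `ρ(z) = 0` for `‖z‖ > R₀`. [folklore] -/
theorem chargeDensity_eq_zero {z : E8} (hz : chargeRadius x ε < ‖z‖) : chargeDensity x ε z = 0 :=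
  Finset.sum_eq_zero fun i _ => by rw [indicator_of_notMem (not_mem_ball_of_chargeRadius_lt x ε hz i), mul_zero]

/-- **`∫ ρ φ = Σᵢ ⨍_{Bᵢ} φ`** for integrable `φ`. [folklore] -/
theorem integral_chargeDensity_mul {φ : E8 → ℝ} (hφ : Integrable φ) :
    ∫ z, chargeDensity x ε z * φ z = ∑ i, ⨍ z in ball (emb (x i)) (ε i), φ z := by
  simp only [chargeDensity, Finset.sum_mul]
  rw [integral_finsetSum _ fun i _ => ?_]
  · refine Finset.sum_congr rfl fun i _ => ?_
    rw [setAverage_eq, smul_eq_mul, ← integral_indicator measurableSet_ball, ← integral_const_mul]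
    refine integral_congr_ae (Eventually.of_forall fun z => ?_)
    by_cases hz : z ∈ ball (emb (x i)) (ε i)
    · simp [indicator_of_mem hz, chargeConst]
    · simp [indicator_of_notMem hz]
  · have : (fun z => chargeConst x ε i * (ball (emb (x i)) (ε i)).indicator (fun _ => (1 : ℝ)) z * φ z) =
        fun z => chargeConst x ε i * (ball (emb (x i)) (ε i)).indicator φ z := by
      funext z
      by_cases hz : z ∈ ball (emb (x i)) (ε i)
      · simp [indicator_of_mem hz]
      · simp [indicator_of_notMem hz]
    rw [this]
    exact (hφ.indicator measurableSet_ball).const_mul _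

/-! ### The Coulomb double integral of `ρ` -/

/-- The mixed potential `x ↦ ∫_{B(c,r)} ‖x - z‖⁻⁶ dz` is strongly measurable. [folklore] -/
theorem stronglyMeasurable_ballPotential (c : E8) (r : ℝ) :
    StronglyMeasurable fun y : E8 => ∫ z in ball c r, ‖y - z‖⁻¹ ^ 6 := by
  have h : (fun y : E8 => ∫ z in ball c r, ‖y - z‖⁻¹ ^ 6) =
      fun y : E8 => ∫ z, (ball c r).indicator (fun z => ‖y - z‖⁻¹ ^ 6) z := by
    funext y; rw [integral_indicator measurableSet_ball]
  rw [h]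
  refine StronglyMeasurable.integral_prod_right (f := fun y z => (ball c r).indicator (fun z => ‖y - z‖⁻¹ ^ 6) z) ?_
  refine Measurable.stronglyMeasurable ?_
  have hk : Measurable fun p : E8 × E8 => ‖p.1 - p.2‖⁻¹ ^ 6 :=
    ((measurable_fst.sub measurable_snd).norm.inv).pow_const 6
  have : uncurry (fun y z => (ball c r).indicator (fun z => ‖y - z‖⁻¹ ^ 6) z) =
      fun p : E8 × E8 => (ball c r).indicator (fun _ => (1 : ℝ)) p.2 * ‖p.1 - p.2‖⁻¹ ^ 6 := by
    funext p
    simp only [uncurry]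
    by_cases hp : p.2 ∈ ball c r
    · rw [indicator_of_mem hp, indicator_of_mem hp, one_mul]
    · rw [indicator_of_notMem hp, indicator_of_notMem hp, zero_mul]
  rw [this]
  exact ((measurable_const.indicator measurableSet_ball).comp measurable_snd).mul hk

/-- The mixed potential is bounded: `0 ≤ ∫_{B(c,r)} ‖y - z‖⁻⁶ dz ≤ (3π⁴/2) r²` (`r ≥ 0`; `= 0` for `r ≤ 0`). [folklore] -/
theorem ballPotential_le (c y : E8) (r : ℝ) : |∫ z in ball c r, ‖y - z‖⁻¹ ^ 6| ≤ 3 / 2 * Real.pi ^ 4 * r ^ 2 := by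
  rw [abs_of_nonneg (integral_nonneg fun _ => by positivity)]
  rcases le_or_gt 0 r with hr | hr
  · exact setIntegral_inv_norm_sub_pow_six_le y c hr
  · rw [ball_eq_empty.2 hr.le, Measure.restrict_empty, integral_zero_measure]; positivity

/-- The inner integral against `ρ`: `∫ ρ(z) ‖y - z‖⁻⁶ dz = Σⱼ cⱼ ∫_{Bⱼ} ‖y - z‖⁻⁶ dz`. [folklore] -/
theorem integral_chargeDensity_mul_kernel (y : E8) :
    ∫ z, chargeDensity x ε z * ‖y - z‖⁻¹ ^ 6 = ∑ j, chargeConst x ε j * ∫ z in ball (emb (x j)) (ε j), ‖y - z‖⁻¹ ^ 6 := by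
  simp only [chargeDensity, Finset.sum_mul]
  have hfun : ∀ j, (fun z => chargeConst x ε j * (ball (emb (x j)) (ε j)).indicator (fun _ => (1 : ℝ)) z * ‖y - z‖⁻¹ ^ 6) =
      fun z => chargeConst x ε j * (ball (emb (x j)) (ε j)).indicator (fun z => ‖y - z‖⁻¹ ^ 6) z := fun j => by
    funext z
    by_cases hz : z ∈ ball (emb (x j)) (ε j)
    · simp [indicator_of_mem hz]
    · simp [indicator_of_notMem hz]
  rw [integral_finsetSum _ fun j _ => ?_]
  · refine Finset.sum_congr rfl fun j _ => ?_
    rw [hfun j, integral_const_mul, integral_indicator measurableSet_ball]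
  · rw [hfun j]
    exact ((integrable_indicator_iff measurableSet_ball).2 (integrableOn_inv_norm_sub_pow_six y _ _)).const_mul _

/-- **Bilinear expansion of the Coulomb double integral**:
`∫ ρ(y) ∫ ρ(z) ‖y - z‖⁻⁶ dz dy = Σᵢ Σⱼ smearedPair xᵢ xⱼ εᵢ εⱼ`. [folklore] -/
theorem coulomb_double_integral_chargeDensity :
    ∫ y, chargeDensity x ε y * ∫ z, chargeDensity x ε z * ‖y - z‖⁻¹ ^ 6 =
      ∑ i, ∑ j, smearedPair (x i) (x j) (ε i) (ε j) := by
  set K : Fin N → E8 → ℝ := fun j y => ∫ z in ball (emb (x j)) (ε j), ‖y - z‖⁻¹ ^ 6 with hK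
  have hKm : ∀ j, StronglyMeasurable (K j) := fun j => stronglyMeasurable_ballPotential _ _
  have hKb : ∀ j y, |K j y| ≤ 3 / 2 * Real.pi ^ 4 * (ε j) ^ 2 := fun j y => ballPotential_le _ _ _
  -- the inner integrals
  have hinner : ∀ y, ∫ z, chargeDensity x ε z * ‖y - z‖⁻¹ ^ 6 = ∑ j, chargeConst x ε j * K j y :=
    integral_chargeDensity_mul_kernel x ε
  simp_rw [hinner]
  -- the outer integral: `ρ(y) Σⱼ cⱼ Kⱼ(y) = Σᵢ Σⱼ cᵢ cⱼ 𝟙ᵢ(y) Kⱼ(y)`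
  have hKi : ∀ i j, Integrable fun y => (ball (emb (x i)) (ε i)).indicator (fun _ => (1 : ℝ)) y * K j y := fun i j => by
    have : (fun y => (ball (emb (x i)) (ε i)).indicator (fun _ => (1 : ℝ)) y * K j y) =
        (ball (emb (x i)) (ε i)).indicator (K j) := by
      funext y
      by_cases hy : y ∈ ball (emb (x i)) (ε i)
      · simp [indicator_of_mem hy]
      · simp [indicator_of_notMem hy]
    rw [this, integrable_indicator_iff measurableSet_ball]
    exact Measure.integrableOn_of_bounded measure_ball_lt_top.ne (hKm j).aestronglyMeasurable
      (Eventually.of_forall fun y => (Real.norm_eq_abs _).le.trans (hKb j y))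
  have hexp : ∀ y, chargeDensity x ε y * ∑ j, chargeConst x ε j * K j y =
      ∑ i, ∑ j, chargeConst x ε i * chargeConst x ε j *
        ((ball (emb (x i)) (ε i)).indicator (fun _ => (1 : ℝ)) y * K j y) := fun y => by
    rw [chargeDensity, Finset.sum_mul]
    refine Finset.sum_congr rfl fun i _ => ?_
    rw [Finset.mul_sum]
    exact Finset.sum_congr rfl fun j _ => by ring
  simp_rw [hexp]
  rw [integral_finsetSum _ fun i _ => integrable_finsetSum _ fun j _ => ((hKi i j).const_mul _)]
  refine Finset.sum_congr rfl fun i _ => ?_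
  rw [integral_finsetSum _ fun j _ => ((hKi i j).const_mul _)]
  refine Finset.sum_congr rfl fun j _ => ?_
  rw [integral_const_mul]
  -- identify with `smearedPair`
  have h1 : ∫ y, (ball (emb (x i)) (ε i)).indicator (fun _ => (1 : ℝ)) y * K j y =
      ∫ y in ball (emb (x i)) (ε i), K j y := by
    rw [← integral_indicator measurableSet_ball]
    refine integral_congr_ae (Eventually.of_forall fun y => ?_)
    by_cases hy : y ∈ ball (emb (x i)) (ε i)
    · simp [indicator_of_mem hy]
    · simp [indicator_of_notMem hy]
  rw [h1, smearedPair, setAverage_eq, smul_eq_mul]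
  simp_rw [setAverage_eq, smul_eq_mul]
  rw [integral_const_mul, hK]
  simp only [chargeConst]
  ring

/-! ### Fields with disjoint supports -/

/-- **Pointwise orthogonality of fields on disjoint tubes**: if `Fᵢ = 0` off `tube Ωᵢ` and the cells `Ωᵢ`
are pairwise disjoint, then `‖Σᵢ Fᵢ(z)‖² = Σᵢ ‖Fᵢ(z)‖²` (at most one term is nonzero). [folklore] -/
theorem norm_sq_sum_of_disjoint_tubes {Ω : Fin N → Set E3} (hdisj : ∀ i j, i ≠ j → Disjoint (Ω i) (Ω j))
    {F : Fin N → E8 → E8} (hF : ∀ i z, z ∉ tube (Ω i) → F i z = 0) (z : E8) :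
    ‖∑ i, F i z‖ ^ 2 = ∑ i, ‖F i z‖ ^ 2 := by
  by_cases h : ∃ i, z ∈ tube (Ω i)
  · obtain ⟨i₀, hi₀⟩ := h
    have hother : ∀ i, i ≠ i₀ → F i z = 0 := fun i hi => hF i z fun hz =>
      Set.disjoint_left.1 (hdisj i i₀ hi) (show proj z ∈ Ω i from hz) (show proj z ∈ Ω i₀ from hi₀)
    rw [Finset.sum_eq_single i₀ (fun i _ hi => hother i hi) (fun h => absurd (Finset.mem_univ i₀) h),
      Finset.sum_eq_single i₀ (fun i _ hi => by rw [hother i hi, norm_zero]; ring)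
        (fun h => absurd (Finset.mem_univ i₀) h)]
  · have h0 : ∀ i, F i z = 0 := fun i => hF i z fun hi => h ⟨i, hi⟩
    simp [h0]


variable {N : ℕ}

/-! ### Near-optimal admissible fluxes -/

/-- For `δ > 0` every cell carries an admissible flux within `δ` of its tube energy. [folklore] -/
theorem exists_admissible_lt {Ω : Set E3} {x : E3} {ε : ℝ} {G : E8 → E8} (hΩ : IsOpen Ω)
    (hball : ball x ε ⊆ Ω) (hG : MemLp G 2 volume) {δ : ℝ} (hδ : 0 < δ) :
    ∃ F ∈ admissible Ω x ε G, ∫ z, ‖F z‖ ^ 2 < tubeEnergy Ω x ε G + δ := by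
  have hne : ((fun F : E8 → E8 => ∫ z, ‖F z‖ ^ 2) '' admissible Ω x ε G).Nonempty :=
    (admissible_nonempty hΩ hball hG).image _
  obtain ⟨a, ⟨F, hF, rfl⟩, ha⟩ := exists_lt_of_csInf_lt hne (lt_add_of_pos_right _ hδ : tubeEnergy Ω x ε G < _)
  exact ⟨F, hF, ha⟩

/-! ### The weak divergence of the glued field -/

/-- Integrability of the pairing of an `L²` field with the gradient of a test function. [folklore] -/
theorem integrable_inner_gradient_test {F : E8 → E8} (hF : MemLp F 2 volume) {φ : E8 → ℝ} (hφ : IsTest φ) :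
    Integrable fun z => ⟪F z, gradient φ z⟫ :=
  integrable_inner_of_memLp_two hF
    ((Literature.Analysis.FluidPDE.continuous_gradient_of_contDiff hφ.1).memLp_of_hasCompactSupport
      ((hφ.2.fderiv (𝕜 := ℝ)).comp_left (g := fun L : E8 →L[ℝ] ℝ => (InnerProductSpace.toDual ℝ E8).symm L)
        (map_zero _)))

/-- **The glued field has weak divergence `ρ`**: for admissible `Fᵢ` on pairwise disjoint open cells and a
transfer field weakly divergence-free on the union of the tubes,
`∫ ⟪Σᵢ Fᵢ, ∇φ⟫ = -∫ ρ φ` for every test `φ`. [folklore] -/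
theorem integral_inner_sum_gradient {x : Fin N → E3} {Ω : Fin N → Set E3} {ε : Fin N → ℝ} {G : E8 → E8}
    (hΩ : ∀ i, IsOpen (Ω i)) (hdisj : ∀ i j, i ≠ j → Disjoint (Ω i) (Ω j)) (hG : MemLp G 2 volume)
    (hdivG : ∀ φ : E8 → ℝ, IsTest φ → ∫ z in tube (⋃ i, Ω i), ⟪G z, gradient φ z⟫ = 0)
    {F : Fin N → E8 → E8} (hF : ∀ i, F i ∈ admissible (Ω i) (x i) (ε i) G) {φ : E8 → ℝ} (hφ : IsTest φ) :
    ∫ z, ⟪∑ i, F i z, gradient φ z⟫ = -∫ z, chargeDensity x ε z * φ z := by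
  have htm : ∀ i, MeasurableSet (tube (Ω i)) := fun i => measurableSet_tube (hΩ i)
  have hFi : ∀ i, Integrable fun z => ⟪F i z, gradient φ z⟫ := fun i => integrable_inner_gradient_test (hF i).1 hφ
  have hGi : Integrable fun z => ⟪G z, gradient φ z⟫ := integrable_inner_gradient_test hG hφ
  -- each summand: `∫⟪Fᵢ, ∇φ⟫ = -⨍_{Bᵢ} φ + ∫_{tube Ωᵢ} ⟪G, ∇φ⟫`
  have hone : ∀ i, ∫ z, ⟪F i z, gradient φ z⟫ =
      -(⨍ z in ball (emb (x i)) (ε i), φ z) + ∫ z in tube (Ω i), ⟪G z, gradient φ z⟫ := fun i => by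
    obtain ⟨-, hvan, hweak⟩ := hF i
    have h1 : ∫ z, ⟪F i z, gradient φ z⟫ = ∫ z in tube (Ω i), ⟪F i z, gradient φ z⟫ :=
      (setIntegral_eq_integral_of_forall_compl_eq_zero fun z hz => by rw [hvan z hz, inner_zero_left]).symm
    have hsub : IntegrableOn (fun z => ⟪F i z - G z, gradient φ z⟫) (tube (Ω i)) := by
      have := ((hFi i).sub hGi).integrableOn (s := tube (Ω i))
      exact this.congr_fun (fun z _ => by simp) (htm i)
    have h2 : ∫ z in tube (Ω i), ⟪F i z, gradient φ z⟫ =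
        (∫ z in tube (Ω i), ⟪F i z - G z, gradient φ z⟫) + ∫ z in tube (Ω i), ⟪G z, gradient φ z⟫ := by
      rw [← integral_add hsub hGi.integrableOn]
      exact integral_congr_ae (Eventually.of_forall fun z => by simp)
    rw [h1, h2, hweak φ hφ]
  -- the wall fluxes of `G` add up to the (vanishing) integral over the union of the tubes
  have hunion : ∑ i, ∫ z in tube (Ω i), ⟪G z, gradient φ z⟫ = 0 := by
    have hset : tube (⋃ i, Ω i) = ⋃ i ∈ (Finset.univ : Finset (Fin N)), tube (Ω i) := by
      rw [tube, preimage_iUnion]; ext z; simp [tube]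
    have h := integral_biUnion_finset (μ := (volume : Measure E8)) (f := fun z => ⟪G z, gradient φ z⟫)
      Finset.univ (s := fun i => tube (Ω i)) (fun i _ => htm i)
      (fun i _ j _ hij => (hdisj i j hij).preimage proj) (fun i _ => hGi.integrableOn)
    rw [← h, ← hset]
    exact hdivG φ hφ
  rw [integral_congr_ae (Eventually.of_forall fun z => sum_inner (𝕜 := ℝ) Finset.univ (fun i => F i z) (gradient φ z)),
    integral_finsetSum _ fun i _ => hFi i]
  simp_rw [hone]
  rw [Finset.sum_add_distrib, hunion, add_zero, Finset.sum_neg_distrib,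
    integral_chargeDensity_mul x ε (hφ.1.continuous.integrable_of_hasCompactSupport hφ.2)]

/-! ### The stub -/

/-- **Registered stub `stub_confinedThomson` (confined Thomson inequality with free transfer, `ℝ⁸`).**
For pairwise disjoint open cells `Ωᵢ ⊂ ℝ³` with `B(xᵢ, εᵢ) ⊆ Ωᵢ`, a transfer field `G ∈ L²(ℝ⁸; ℝ⁸)` with
`∫_{tube ⋃Ωᵢ} ⟪G, ∇φ⟫ = 0` for all tests `φ`:
`Σᵢ Σ_{j≠i} smearedPair xᵢ xⱼ εᵢ εⱼ ≤ Σᵢ fluxCell Ωᵢ xᵢ εᵢ G`. [cite: LiebLoss2001, Thm 9.8] -/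
theorem stub_confinedThomson : ConfinedThomson := by
  intro N x Ω ε G hΩ hdisj hball hG hdivG
  classical
  -- the total (self + cross) smeared energy is dominated by `2π⁴ Σ tubeEnergy`
  have hmain : ∑ i, ∑ j, smearedPair (x i) (x j) (ε i) (ε j) ≤ 2 * Real.pi ^ 4 * ∑ i, tubeEnergy (Ω i) (x i) (ε i) G := by
    refine le_of_forall_pos_le_add fun δ hδ => ?_
    -- near-optimal admissible fluxes, with slack `δ' = δ / (2π⁴ (N + 1))`
    set δ' : ℝ := δ / (2 * Real.pi ^ 4 * ((N : ℝ) + 1)) with hδ'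
    have hδ'pos : 0 < δ' := by positivity
    have hex : ∀ i, ∃ F ∈ admissible (Ω i) (x i) (ε i) G, ∫ z, ‖F z‖ ^ 2 < tubeEnergy (Ω i) (x i) (ε i) G + δ' :=
      fun i => exists_admissible_lt (hΩ i) (hball i) hG hδ'pos
    choose F hFadm hFlt using hex
    -- the glued field and its weak divergence
    have hmem : MemLp (fun z => ∑ i, F i z) 2 volume := memLp_finsetSum _ fun i _ => (hFadm i).1
    have hdiv : ∀ φ : E8 → ℝ, ContDiff ℝ 1 φ → HasCompactSupport φ →
        ∫ z, ⟪∑ i, F i z, gradient φ z⟫ = -∫ z, chargeDensity x ε z * φ z :=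
      fun φ hφ hφc => integral_inner_sum_gradient hΩ hdisj hG hdivG hFadm ⟨hφ, hφc⟩
    -- Thomson
    have hT := coulomb_double_integral_le_of_weakDiv (integrable_chargeDensity x ε) (abs_chargeDensity_le x ε)
      (fun z hz => chargeDensity_eq_zero x ε hz) (chargeRadius_nonneg x ε) hmem hdiv
    rw [coulomb_double_integral_chargeDensity] at hT
    -- the field energy splits over the cells
    have hsplit : ∫ z, ‖∑ i, F i z‖ ^ 2 = ∑ i, ∫ z, ‖F i z‖ ^ 2 := by
      rw [← integral_finsetSum _ fun i _ => (memLp_two_iff_integrable_sq_norm (hFadm i).1.1).1 (hFadm i).1]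
      exact integral_congr_ae (Eventually.of_forall fun z =>
        norm_sq_sum_of_disjoint_tubes hdisj (fun i z hz => (hFadm i).2.1 z hz) z)
    rw [hsplit] at hT
    have hsum : ∑ i, ∫ z, ‖F i z‖ ^ 2 ≤ ∑ i, tubeEnergy (Ω i) (x i) (ε i) G + ((N : ℝ) + 1) * δ' := by
      calc ∑ i, ∫ z, ‖F i z‖ ^ 2 ≤ ∑ i, (tubeEnergy (Ω i) (x i) (ε i) G + δ') :=
            Finset.sum_le_sum fun i _ => (hFlt i).le
        _ = ∑ i, tubeEnergy (Ω i) (x i) (ε i) G + (N : ℝ) * δ' := by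
            rw [Finset.sum_add_distrib, Finset.sum_const, Finset.card_univ, Fintype.card_fin, nsmul_eq_mul]
        _ ≤ _ := by nlinarith
    have hNδ : 2 * Real.pi ^ 4 * (((N : ℝ) + 1) * δ') = δ := by
      rw [hδ']; field_simp
    calc ∑ i, ∑ j, smearedPair (x i) (x j) (ε i) (ε j) ≤ 2 * Real.pi ^ 4 * ∑ i, ∫ z, ‖F i z‖ ^ 2 := hT
      _ ≤ 2 * Real.pi ^ 4 * (∑ i, tubeEnergy (Ω i) (x i) (ε i) G + ((N : ℝ) + 1) * δ') := by gcongr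
      _ = 2 * Real.pi ^ 4 * ∑ i, tubeEnergy (Ω i) (x i) (ε i) G + δ := by rw [mul_add, hNδ]
  -- subtract the self terms
  have herase : ∀ i, ∑ j ∈ Finset.univ.erase i, smearedPair (x i) (x j) (ε i) (ε j) =
      ∑ j, smearedPair (x i) (x j) (ε i) (ε j) - smearedPair (x i) (x i) (ε i) (ε i) := fun i =>
    Finset.sum_erase_eq_sub (Finset.mem_univ i)
  simp_rw [herase, fluxCell]
  rw [Finset.sum_sub_distrib, Finset.sum_sub_distrib, ← Finset.mul_sum]
  linarith

end Summit.AtomisticToContinuum.Crystallization.Theorems.PricedLinkCensusLocalToGlobal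

end
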